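import Literature.MathematicalPhysics.QuantumLattice.GrassmannGaussConvKernelBound
import HarnessLib

/-!
# The Wick contraction with a LOCALISED covariance: weighted and far-supported forms of the one-Laplacian kernel bound

Topic `MathematicalPhysics/QuantumLattice`; continuation of `GrassmannGaussConvKernelBound` (`kernel_grassmannLaplacian`: the degree-`m`
kernel of `Δ_C W` is the degree-`m+2` kernel of `W` contracted with `C` on its last two legs; `sum_norm_kernel_grassmannLaplacian_le`: one
contraction costs the SUP norm of the covariance).  When the covariance is not uniformly small but LOCALISED — `‖C(A,B)‖ ≤ ω(A)` for a
weight `ω` on the contracted leg (Benfatto–Giuliani–Mastropietro 2006, §3 (3.2)–(3.8): the moment bookkeeping; Salmhofer 1999, (4.86)) — the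
same identity gives the contraction bound with the weight moved onto the corresponding leg of the input kernel:

* **`sum_norm_kernel_grassmannLaplacian_le_weighted`** — `Σ_{X : X_i = w} ‖kernel (Δ_C W) m X‖ ≤ ((m+1)(m+2)/2) · Σ_{Z : Z_i = w} ω(Z_{m+1}) ‖kernel W (m+2) Z‖`
  (`Z_{m+1}` = the last leg, the first index of the contracted pair);
* **`sum_norm_kernel_grassmannLaplacian_le_of_far`** — FAR-SUPPORTED covariance: if `C(A,B) = 0` unless `A ∈ Zs`, `‖C(A,B)‖ ≤ s`, and
  `R ≤ d w A` for every `A ∈ Zs` (`d ≥ 0` any "distance from the pin"), then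
  `Σ_{X : X_i = w} ‖kernel (Δ_C W) m X‖ ≤ ((m+1)(m+2)/2) · (s/R) · Σ_{Z : Z_i = w} d w (Z_{m+1}) ‖kernel W (m+2) Z‖` — a contraction with a
  covariance supported at distance `≥ R` from the pinned leg costs the FIRST MOMENT of the input kernel over `R` (the far half of the
  defect-covariance step of a nested two-volume comparison).

Everything is proved; no definition, no named fact.

## Sources
G. Benfatto, A. Giuliani, V. Mastropietro, Ann. Henri Poincaré 7 (2006) 809–898, (2.86)–(2.90), §3 (3.2)–(3.8) [`BenfattoGiulianiMastropietro2006`];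
M. Salmhofer, *Renormalization: An Introduction* (Springer 1999), §4.3.2 (4.86) [`Salmhofer1999`].
-/

noncomputable section

namespace Literature.MathematicalPhysics.QuantumLattice

open GrassmannAlgebra Finset
open scoped Nat

variable {𝕜 : Type*} [RCLike 𝕜] {Γ : Type*} [Fintype Γ] [DecidableEq Γ]

/-- **The weighted Wick bound for one Laplacian, one output leg pinned**: if `‖C(A,B)‖ ≤ ω A`, then
`Σ_{X : X_i = w} ‖kernel (Δ_C W) m X‖ ≤ ((m+1)(m+2)/2) · Σ_{Z : Z_i = w} ω(Z_{last}) ‖kernel W (m+2) Z‖`.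
[cite: BenfattoGiulianiMastropietro2006, (2.86)-(2.90) and §3 (3.2)-(3.8)] -/
theorem sum_norm_kernel_grassmannLaplacian_le_weighted (C : Matrix Γ Γ 𝕜) {ω : Γ → ℝ} (hω : ∀ A B, ‖C A B‖ ≤ ω A) (W : GrassmannAlgebra 𝕜 Γ) (m : ℕ) (i : Fin m) (w : Γ) :
    ∑ X ∈ univ.filter (fun X : Fin m → Γ => X i = w), ‖kernel 𝕜 (grassmannLaplacian 𝕜 C W) m X‖ ≤
      (((m + 1) * (m + 2) : ℕ) : ℝ) / 2 *
        ∑ Z ∈ univ.filter (fun Z : Fin (m + 1 + 1) → Γ => Z (Fin.castSucc (Fin.castSucc i)) = w),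
          ω (Z (Fin.last (m + 1))) * ‖kernel 𝕜 W (m + 2) Z‖ := by
  have hcoef : ‖(((((m + 1) * (m + 2) : ℕ) : ℚ) / 2) • (1 : 𝕜))‖ = (((m + 1) * (m + 2) : ℕ) : ℝ) / 2 := by
    rw [Rat.smul_one_eq_cast, ← RCLike.ofReal_ratCast, RCLike.norm_ofReal]
    push_cast
    exact abs_of_nonneg (by positivity)
  -- pointwise
  have hpt : ∀ X : Fin m → Γ, ‖kernel 𝕜 (grassmannLaplacian 𝕜 C W) m X‖ ≤
      (((m + 1) * (m + 2) : ℕ) : ℝ) / 2 *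
        ∑ A, ∑ B, ω A * ‖kernel 𝕜 W (m + 2) (Fin.snoc (Fin.snoc X B : Fin (m + 1) → Γ) A)‖ := by
    intro X
    rw [kernel_grassmannLaplacian, norm_mul, hcoef]
    refine mul_le_mul_of_nonneg_left ?_ (by positivity)
    refine (norm_sum_le _ _).trans (sum_le_sum fun A _ => ?_)
    refine (norm_sum_le _ _).trans (sum_le_sum fun B _ => ?_)
    rw [norm_mul]
    exact mul_le_mul_of_nonneg_right (hω A B) (norm_nonneg _)
  refine (sum_le_sum fun X _ => hpt X).trans (le_of_eq ?_)
  rw [← mul_sum]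
  congr 1
  rw [← sum_filter_sum_sum_snoc_snoc_eq (fun Z : Fin (m + 1 + 1) → Γ => ω (Z (Fin.last (m + 1))) * ‖kernel 𝕜 W (m + 2) Z‖) i w]
  refine sum_congr rfl fun X _ => sum_congr rfl fun A _ => sum_congr rfl fun B _ => ?_
  simp only [Fin.snoc_last]

/-- **The Wick bound for a FAR-SUPPORTED covariance**: if `C(A,B) = 0` unless `A ∈ Zs`, `‖C(A,B)‖ ≤ s`, and every `A ∈ Zs` has `R ≤ d w A`
for a nonnegative "distance from the pin" `d w ·` and `R > 0`, then
`Σ_{X : X_i = w} ‖kernel (Δ_C W) m X‖ ≤ ((m+1)(m+2)/2) · (s/R) · Σ_{Z : Z_i = w} d w (Z_{last}) ‖kernel W (m+2) Z‖` — the first moment of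
the input kernel between the pinned leg and the contracted leg, over `R`. [cite: BenfattoGiulianiMastropietro2006, §3 (3.2)-(3.8)] -/
theorem sum_norm_kernel_grassmannLaplacian_le_of_far (C : Matrix Γ Γ 𝕜) {Zs : Set Γ} (hC : ∀ A B, A ∉ Zs → C A B = 0)
    {s : ℝ} (hs0 : 0 ≤ s) (hs : ∀ A B, ‖C A B‖ ≤ s) (d : Γ → Γ → ℝ) (hd0 : ∀ w A, 0 ≤ d w A) {R : ℝ} (hR : 0 < R) (w : Γ)
    (hfar : ∀ A, A ∈ Zs → R ≤ d w A) (W : GrassmannAlgebra 𝕜 Γ) (m : ℕ) (i : Fin m) :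
    ∑ X ∈ univ.filter (fun X : Fin m → Γ => X i = w), ‖kernel 𝕜 (grassmannLaplacian 𝕜 C W) m X‖ ≤
      (((m + 1) * (m + 2) : ℕ) : ℝ) / 2 * (s / R) *
        ∑ Z ∈ univ.filter (fun Z : Fin (m + 1 + 1) → Γ => Z (Fin.castSucc (Fin.castSucc i)) = w),
          d w (Z (Fin.last (m + 1))) * ‖kernel 𝕜 W (m + 2) Z‖ := by
  classical
  -- the weight `ω A = (s/R)·d w A` dominates the far-supported entries
  have hω : ∀ A B, ‖C A B‖ ≤ s / R * d w A := by
    intro A B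
    by_cases hA : A ∈ Zs
    · calc ‖C A B‖ ≤ s := hs A B
        _ = s / R * R := by field_simp
        _ ≤ s / R * d w A := mul_le_mul_of_nonneg_left (hfar A hA) (div_nonneg hs0 hR.le)
    · rw [hC A B hA, norm_zero]; exact mul_nonneg (div_nonneg hs0 hR.le) (hd0 w A)
  have h := sum_norm_kernel_grassmannLaplacian_le_weighted C (ω := fun A => s / R * d w A) hω W m i w
  refine h.trans (le_of_eq ?_)
  simp_rw [mul_assoc (s / R), ← Finset.mul_sum]
  ring

end Literature.MathematicalPhysics.QuantumLattice

end
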